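import Summits.Ventures.GridStability.Lyapunov.PolyRecast
import Mathlib.Topology.Algebra.Ring.Basic
import Mathlib.Topology.Instances.Real.Lemmas
import HarnessLib

/-!
# GridStability/Lyapunov/PolyRecastEval — continuity and value-at-the-origin of an emitted `Poly` on `Fin N → ℝ`

Cell `gridfusion` (LADDER-GRIDFUSION), `plan/PARTITION.md` §0 row `Lyapunov/` (generic glue; seat gridfusion-sos-3
(g3) for the deg-4 WSCC9 «…Roa» companions, namespace `Summit.Ventures.GridStability.Lyapunov.PolyRecast`,
extending lyap-1's `PolyRecast.lean`). PURPOSE: a Bench certificate whose Lyapunov function has more than the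
emitter's 150 monomials (deg-4 WSCC9: 253 / 324 terms) carries NO explicit `…_V_eq` lemma, so the «…Roa» files
cannot get `Continuous V` from `fun_prop` on an explicit polynomial, nor `V 0 = 0` from `simp`. Both facts are
proved here ONCE for every `p : Poly` read on the phase space `Fin N → ℝ` through `vars (List.ofFn w)`:

* `continuous_evalFrom_ofFn`, `continuous_eval_ofFn` — `w ↦ p.eval (vars (List.ofFn w))` is continuous;
* `vars_ofFn_zero` — the variable vector of the origin is the zero assignment;
* `evalFrom_zero_of_any`, `eval_zero_assignment_of_all` / `eval_ofFn_zero_of_all` — if every monomial of `p`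
  has a nonzero exponent (a `decide`-able `List.all`/`List.any` test on the literal), then `p` vanishes at the
  origin.

Pure bookkeeping: no definition, no named fact, standard axioms.
-/

noncomputable section

open Set Filter Topology
open Literature.Computation.Certificates Literature.Computation.Certificates.SOS

namespace Summit.Ventures.GridStability.Lyapunov.PolyRecast

/-- The `k`-th coordinate read through `vars (List.ofFn w)` is continuous in `w : Fin N → ℝ` (it is a
coordinate projection for `k < N` and the constant `0` beyond). [folklore] -/
theorem continuous_vars_ofFn {N : ℕ} (k : ℕ) :
    Continuous fun w : Fin N → ℝ => vars (List.ofFn w) k := by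
  by_cases hk : k < N
  · have : (fun w : Fin N → ℝ => vars (List.ofFn w) k) = fun w => w ⟨k, hk⟩ := by
      funext w; exact vars_ofFn_of_lt w hk
    rw [this]
    exact continuous_apply _
  · have : (fun w : Fin N → ℝ => vars (List.ofFn w) k) = fun _ => 0 := by
      funext w; exact vars_ofFn_of_le w (not_lt.1 hk)
    rw [this]
    exact continuous_const

/-- Every monomial value `evalFrom (vars (List.ofFn w)) k m` is continuous in `w`. [folklore] -/
theorem continuous_evalFrom_ofFn {N : ℕ} :
    ∀ (m : Monomial) (k : ℕ), Continuous fun w : Fin N → ℝ => Monomial.evalFrom (vars (List.ofFn w)) k m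
  | [], k => by simpa using continuous_const
  | e :: es, k => by
      simp only [Monomial.evalFrom_cons]
      exact ((continuous_vars_ofFn k).pow e).mul (continuous_evalFrom_ofFn es (k + 1))

/-- **Continuity of an emitted polynomial on the phase space**: `w ↦ p.eval (vars (List.ofFn w))` is
continuous for every `p : Poly`. [folklore] -/
theorem continuous_eval_ofFn {N : ℕ} :
    ∀ p : Poly, Continuous fun w : Fin N → ℝ => Poly.eval (vars (List.ofFn w)) p
  | [] => by simpa using continuous_const
  | (m, c) :: p => by
      simp only [Poly.eval_cons, Monomial.eval_eq]
      exact (continuous_const.mul (continuous_evalFrom_ofFn m 0)).add (continuous_eval_ofFn p)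

/-- At the origin of `Fin N → ℝ` the variable vector is the zero assignment. [folklore] -/
theorem vars_ofFn_zero {N : ℕ} : vars (List.ofFn (0 : Fin N → ℝ)) = fun _ => (0 : ℝ) := by
  funext k
  by_cases hk : k < N
  · rw [vars_ofFn_of_lt _ hk]; rfl
  · exact vars_ofFn_of_le _ (not_lt.1 hk)

/-- A monomial with some nonzero exponent vanishes at the zero assignment. [folklore] -/
theorem evalFrom_zero_of_any :
    ∀ (m : Monomial) (k : ℕ), (m.any fun e => decide (e ≠ 0)) = true →
      Monomial.evalFrom (fun _ : ℕ => (0 : ℝ)) k m = 0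
  | [], k, h => by simp at h
  | e :: es, k, h => by
      simp only [List.any_cons, Bool.or_eq_true, decide_eq_true_eq] at h
      simp only [Monomial.evalFrom_cons]
      rcases h with he | hes
      · simp [zero_pow he]
      · rw [evalFrom_zero_of_any es (k + 1) hes, mul_zero]

/-- **Value at the origin**: if every monomial of `p` has a nonzero exponent (a `decide`-able test on the
literal), then `p` vanishes at the zero assignment. [folklore] -/
theorem eval_zero_assignment_of_all :
    ∀ p : Poly, (p.all fun t => t.1.any fun e => decide (e ≠ 0)) = true →
      Poly.eval (fun _ : ℕ => (0 : ℝ)) p = 0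
  | [], _ => by simp
  | (m, c) :: p, h => by
      simp only [List.all_cons, Bool.and_eq_true] at h
      simp only [Poly.eval_cons, Monomial.eval_eq]
      rw [evalFrom_zero_of_any m 0 h.1, eval_zero_assignment_of_all p h.2]
      simp

/-- The same on the phase space `Fin N → ℝ`: `p.eval (vars (List.ofFn 0)) = 0`. [folklore] -/
theorem eval_ofFn_zero_of_all {N : ℕ} (p : Poly)
    (h : (p.all fun t => t.1.any fun e => decide (e ≠ 0)) = true) :
    Poly.eval (vars (List.ofFn (0 : Fin N → ℝ))) p = 0 := by
  rw [vars_ofFn_zero]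
  exact eval_zero_assignment_of_all p h

end Summit.Ventures.GridStability.Lyapunov.PolyRecast

end
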